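import Literature.AnabelianGeometry.EtaleTheta.Discharge.Sec4Prop42SubRootCoverLaws

/-!
# [EtTh] Prop 4.2 (iii) ∧ (iv) AT THE CANONICAL MODEL under the ROOTS READING of the
# `(N, H_⊙^{bs-fld})`-saturation slot — an `NH`-free floor

Mochizuki, *The étale theta function and its Frobenioid-theoretic manifestations*, Publ. RIMS **45** (2009),
§4, Def. 4.1 (iii)(a) and Prop. 4.2 (iv), proof PDF p. 90 L14–17 (printed p. 316)
[cite: MochizukiEtTh2009, Prop 4.2 p.90]: «it follows from the `(N, H_⊙, f|_{A_N})`-saturated-ness condition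
… [cf. also Proposition 3.4, (ii)] that the pull-back `∈ O^×(A_N)` … of any element `∈ O^×(A_⊙)` [via the
pull-back portion of `α`] admits an `N`-th root», and [FrdII] Def. 2.2 (ii) / Rmk. 2.2.1 (kurims p. 18).
abc-iut cell, layer L2, plan/L2/SUBDAG-EtTh-Prop42.md (custodian abc-iut-w5-d134), seat abc-iut-w4-d044
(gen 3); DAG nodes `EtTh:Prop4.2(iii)`, `EtTh:Prop4.2(iv)`.  PROOF-ONLY file (0 `def`s): a COROLLARY of this
lineage's `prop42_iii_iv_mkOfModelCanonical_of_laws` (`Sec4Prop42SubRootCoverLaws.lean`, p428253) at ONE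
admissible value of its universally quantified parameter `NH`; nothing landed is edited or restated.

## The reading (HONEST LABEL)

The `(N, H_⊙^{bs-fld})`-saturation predicate of the §4 setting ([FrdII] Def. 2.2 (ii): (a) `μ_N`-saturated,
(b) Galois base, (c) `H ↠ H_A` induces isomorphisms on `H¹(−, μ_N)`, `H¹(−, ℤ/N)` and a surjection on
`H²(−, μ_N)`) is a FREE field `IsNHSaturatedBsFld` of `BiKummerSetting` (TODO-merge(abc-iut-L1-t4): the
base-field-theoretic hull `C^{bs-fld}` as a `p`-adic Frobenioid), and a parameter `NH` of abc-iut-L2-t9's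
`mkOfModelCanonical`.  Here that parameter is INSTANTIATED by the lambda

  `NH A N := ∀ (g : A^bs ⟶ A_⊙^bs) (ξ ∈ B(A_⊙^bs)), Div_B ξ = 1 → ∃ ζ ∈ B(A^bs), ζ^N = B(g)(ξ)`

— «every `Div_B`-trivial element of `B(A_⊙^bs)` (a unit of `A_⊙`, i.e. a CONSTANT, [EtTh] Prop. 3.4 (ii))
acquires an `N`-th root in `B(A^bs)` along every base arrow».  This is the CONSEQUENCE that [FrdII]
Rmk. 2.2.1 draws from condition (c) (for `H`-invariant units; abc-iut-L1's PROVED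
`PadicKummer.Def22Context.smul_eq_of_isNHSaturated` / `InvariantsAdmitRoots`, cited as the SOURCE of the
reading, not consumed) — it is WEAKER than print's cohomological definition and it is exactly, and only, what
the proof of Prop. 4.2 (iv) uses (p. 90 L14–17; sub-node L05 `UnitRootsUpstairs`).  Nothing here claims that
the reading IS [FrdII] Def. 2.2 (ii); downstream users of (N,H)-saturation through cohomology ([FrdII]
Thm. 2.4, [EtTh] §5 Kummer classes) are NOT served by it.  No new `def … : Prop` (D-0067 (5)): the reading
is a term substituted for a ∀-quantified parameter of landed theorems.

## What is proved

* `Prop42Sub.constantRoots_rootsReading` — under the reading, the roots-of-constants law `hL`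
  (plan/GAP-LEDGER.md G-w4d044-1) is TAUTOLOGICAL;
* `Prop42Sub.prop42_iii_iv_mkOfModelCanonical_rootsReading (hΦd) (hDSpull) (hR) (hK) (hS)` — [EtTh]
  Prop. 4.2 (iii) ∧ (iv) AS TYPED at the canonical model with the roots reading, where the refinement law
  `hE` (G-w4d044-2) has become the `NH`-FREE **Kummer-cover law**
  `hK := ∀ N, ∀ Frobenius-trivial Galois A', ∃ Galois μ_N-saturated pull-back refinement A'' ⟶ A' over which
  every Div_B-trivial element of B(A_⊙^bs) becomes an N-th power along every A''^bs ⟶ A_⊙^bs`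
  ([FrdII] Rmk. 2.2.1 «after pull-back to an (N,H)-saturated object» + Def. 2.1 (i); for the constant field
  of a `p`-adic tempered Frobenioid: finite Kummer theory of `K(μ_N, (O_K^×)^{1/N})/K`).

NODE READING (no side taken on anything downstream; [EtTh] is a refereed prerequisite paper): at the
canonical model WITH THE ROOTS READING, [EtTh] Prop. 4.2 (iii) ∧ (iv) ⇐ { `Φ` divisorial, `hDSpull` ([FrdI]
Prop. 4.1 (iii)), `hR` (G-w4d044-3, ERRATUM E2 root law), `hK` (Kummer-cover law), `hS` (Def. 4.1 (ii)
naturality — a theorem at the temperoid) } — four laws on the base data `(D, Φ, B, IG, gS)`, no dependence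
on the `(N,H)`-saturation slot.  The general-`NH` theorems of p428253 remain the statements of record; the
GAP rows G-w4d044-1 and G-w4d044-2 stay OPEN at the faithful reading.
-/

noncomputable section

namespace Literature.AnabelianGeometry.EtaleTheta

open CategoryTheory Opposite Literature.AlgebraicGeometry.Frobenioids

universe u₀ v₀ u v w

variable {K : Type u₀} [Field K]

namespace BiKummerSetting

section Canonical

variable (X : SemiGraphs.TemperedArithmeticGroup.{u₀} K) {D₀ : Type u₀}
  [Category.{v₀} D₀] {V : FrdIMonoidStub.{w}} {T : RealifiedDivisorMonoids (D₀ := D₀) V}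
  {D : Type u} [Category.{v} D] {VD : FrdICatStub.{u, v, w} D}
  (tf : TemperedFrobenioid T D VD) (hZ : tf.monoidType = MonoidType.Z)
  (hP : ∀ A : Dᵒᵖ, IsPerfect (tf.Φ.carrier A)) (IG : D → Prop) (gS : ∀ A : D, IG A → (X.Pi →* Aut A))
  (gSs : ∀ (A : D) (h : IG A), Function.Surjective (gS A h)) (A₀ : tf.category)
  (hA₀ : PreFrobenioid.IsFrobeniusTrivial tf.toElem A₀) (hA₀' : IG A₀.base)

/-- **Under the ROOTS READING of the `(N, H_⊙^{bs-fld})`-saturation slot, the roots-of-constants law `hL`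
of `prop42_iv_mkOfModelCanonical_of_constantRoots` (GAP G-w4d044-1) is tautological** — the reading SAYS that
`Div_B`-trivial elements of `B(A_⊙^bs)` acquire `N`-th roots along every base arrow into `A_⊙^bs`.
[cite: MochizukiEtTh2009, Prop 4.2 p.90] -/
theorem Prop42Sub.constantRoots_rootsReading (Hbs : Subgroup (Field.absoluteGaloisGroup K))
    (A'' : tf.category) (N : ℕ+) (g : A''.base ⟶ A₀.base) (ξ : tf.ratFnFunctor.obj (op A₀.base))
    (_hft : PreFrobenioid.IsFrobeniusTrivial tf.toElem A'')
    (hNH : (fun (_ : Subgroup (Field.absoluteGaloisGroup K)) (A : tf.category) (M : ℕ+) =>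
        ∀ (b : A.base ⟶ A₀.base) (x : tf.ratFnFunctor.obj (op A₀.base)),
          divB tf.divisorMonoid tf.ratFnFunctor tf.divBNatTrans (op A₀.base) x = 1 →
            ∃ ζ : tf.ratFnFunctor.obj (op A.base), ζ ^ (M : ℕ) = pull tf.ratFnFunctor b x) Hbs A'' N)
    (hξ : divB tf.divisorMonoid tf.ratFnFunctor tf.divBNatTrans (op A₀.base) ξ = 1) :
    ∃ ζ : tf.ratFnFunctor.obj (op A''.base), ζ ^ (N : ℕ) = pull tf.ratFnFunctor g ξ :=
  hNH g ξ hξ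

/-- **[EtTh] Prop. 4.2 (iii) ∧ (iv) AS TYPED at the canonical model AT THE ROOTS READING of the
`(N, H_⊙^{bs-fld})`-saturation slot (a reading WEAKER than print's cohomological [FrdII] Def. 2.2 (ii)(c); GAP
rows G-w4d044-1 and G-w4d044-2 stay open at the faithful reading) — the `NH`-free floor**: `Φ` divisorial, the [FrdI] Prop. 4.1 (iii)
coprimality-pull-back law `hDSpull`, the tempered-meromorphic root law `hR` (ERRATUM E2; G-w4d044-3), the
Kummer-cover law `hK` ([FrdII] Rmk. 2.2.1 + Def. 2.1 (i)) and the naturality law `hS` (Def. 4.1 (ii)).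
Corollary of `prop42_iii_iv_mkOfModelCanonical_of_laws` with `NH :=` the roots reading: `hE := hK`, `hL`
tautological (`constantRoots_rootsReading`). [cite: MochizukiEtTh2009, Prop 4.2 p.88] -/
theorem Prop42Sub.prop42_iii_iv_mkOfModelCanonical_rootsReading
    (hΦd : Objectwise (fun M _ => IsDivisorial M) tf.divisorMonoid)
    (hDSpull : ∀ {A A' : D} (e : A' ⟶ A) {a b : tf.Φ.carrier (op A)},
      (∀ x : tf.Φ.carrier (op A), x ∣ a → x ∣ b → x = 1) →
        ∀ y : tf.Φ.carrier (op A'), y ∣ pull tf.divisorMonoid e a → y ∣ pull tf.divisorMonoid e b → y = 1)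
    (hR : ∀ (N : ℕ+) (A : D), IG A → ∀ f : tf.ratFnFunctor.obj (op A),
      ∃ (A' : D) (_ : IG A') (b : A' ⟶ A) (g : tf.ratFnFunctor.obj (op A')),
        g ^ (N : ℕ) = pull tf.ratFnFunctor b f)
    (hK : ∀ (N : ℕ+) (A' : tf.category), PreFrobenioid.IsFrobeniusTrivial tf.toElem A' → IG A'.base →
      ∃ (A'' : tf.category) (ψ : A'' ⟶ A'), PreFrobenioid.IsPullbackMorphism tf.toElem ψ ∧ IG A''.base ∧
        tf.IsMuSaturated A'' N ∧
          ∀ (b : A''.base ⟶ A₀.base) (x : tf.ratFnFunctor.obj (op A₀.base)),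
            divB tf.divisorMonoid tf.ratFnFunctor tf.divBNatTrans (op A₀.base) x = 1 →
              ∃ ζ : tf.ratFnFunctor.obj (op A''.base), ζ ^ (N : ℕ) = pull tf.ratFnFunctor b x)
    (hS : ∀ ⦃A B : D⦄ (hA : IG A) (hB : IG B) (b : B ⟶ A),
      ∃ c : X.Pi, ∀ g : X.Pi, (gS B hB g).hom ≫ b = b ≫ (gS A hA (c * g * c⁻¹)).hom) :
    (mkOfModelCanonical X tf hZ hP IG gS gSs
        (fun _ A M => ∀ (b : A.base ⟶ A₀.base) (x : tf.ratFnFunctor.obj (op A₀.base)),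
          divB tf.divisorMonoid tf.ratFnFunctor tf.divBNatTrans (op A₀.base) x = 1 →
            ∃ ζ : tf.ratFnFunctor.obj (op A.base), ζ ^ (M : ℕ) = pull tf.ratFnFunctor b x)
        A₀ hA₀ hA₀').Prop42_iii (fun {_ _} φ x => tf.pullFracModel φ x) ∧
      (mkOfModelCanonical X tf hZ hP IG gS gSs
        (fun _ A M => ∀ (b : A.base ⟶ A₀.base) (x : tf.ratFnFunctor.obj (op A₀.base)),
          divB tf.divisorMonoid tf.ratFnFunctor tf.divBNatTrans (op A₀.base) x = 1 →
            ∃ ζ : tf.ratFnFunctor.obj (op A.base), ζ ^ (M : ℕ) = pull tf.ratFnFunctor b x)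
        A₀ hA₀ hA₀').Prop42_iv (fun φ x => tf.pullFracModel φ x) :=
  Prop42Sub.prop42_iii_iv_mkOfModelCanonical_of_laws X tf hZ hP IG gS gSs _ A₀ hA₀ hA₀' hΦd hDSpull hR hK hS
    (fun _ _ g ξ _ hNH hξ => hNH g ξ hξ)

end Canonical

end BiKummerSetting

end Literature.AnabelianGeometry.EtaleTheta

end
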